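import Summits.ResolutionOfSingularities.ResolutionOfSingularities.Theses.TropicalLinks
import Summits.ResolutionOfSingularities.ResolutionOfSingularities.Theorems.TropicalLinksInductiveStepOffTropical
import Summits.ResolutionOfSingularities.ResolutionOfSingularities.Theorems.TropicalLinksInductiveStepExtIdealPresentation
import Summits.ResolutionOfSingularities.ResolutionOfSingularities.Theorems.SchonResolves.Negative.InitialFormMul

/-!
# `SchonResolves` (crux stmt-ResolutionOfSingularities-17234, route `TropicalLinks`):
# the re-embedding CHOICE `∃ (m, G)` in the antecedent is load-bearing
# (negative-side support, refuter cdisprove seat, gen 2; this file does NOT refute the crux)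

The crux is `∀ p prime, (∀ d, SchonAt p d) → Conclusion p`; its only hypothesis is the route's typed
Tevelev conjecture `SchonAt` ("every `d`-dimensional prime `I ⊆ k[ℤ^N]` admits SOME guarded
re-embedding `G : Fin m → k[ℤ^N]`, `G j ∉ I`, whose unit-graph ideal `I' ⊆ k[ℤ^(N+m)]` has ALL initial
degenerations `k[ℤ^(N+m)] ⧸ in_w(I')` regular"). The standing disprover's cycle-1 record
(`Cruxes/SchonResolves/Disproof.lean`, `Negative/SchonResolvesLoadBearing.lean`) settles that no
`_false_without_` lemma can touch the antecedent short of refuting resolution in characteristic `p`.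
What CAN be kernel-checked about the antecedent is WHERE its content sits, and this file does it on the
smallest example (first computed non-trivial initial degeneration of the route's typed terms):

* `exists_guarded_reembedding_not_schonClause` (§2, route-native, any field `k`): for `U = 𝔾_m`
  (`N = 1`, `I = ⊥`, prime, `dim U = 1`) the guard-passing choice `m = 1`, `G = (x₁ − 1)²` VIOLATES the
  schön clause — verbatim the route's `∀ w P, IsRegularLocalRing (Localization.AtPrime P)` — although
  `U[G⁻¹] = 𝔾_m ∖ {1}` is regular (clause true at `w = 0`) and `U` is schön already with `m = 0`:
  `U[G⁻¹]` re-embedded as the smooth curve `{y = (x−1)²} ⊆ 𝔾_m²` degenerates at `w = (0,1)` to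
  `k[x^±, y^±] ⧸ ⟨(x−1)²⟩`, regular at no prime. So the `∃ (m, G)` of `SchonAt` is a genuine CHOICE
  (the `∀`-strengthening over guarded re-embeddings is false at `d = 1` for every `p`), and the clause at
  `w ≠ 0` sees the EMBEDDING (the unit lattice generated by `x, G`), not only the variety `U[G⁻¹]`:
  here `⟨x₁, (x₁−1)²⟩` has index 2 in the unit lattice `⟨x₁, x₁ − 1⟩` and the missing unit appears as
  the non-reduced initial form; adjoining `x₁ − 1` as a further `G` (the intrinsic embedding,
  Luxton–Qu 2011 Lemma 2.13) repairs it (on paper). For provers of `SchonResolves`: the `G` handed over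
  by the antecedent carry information that `U[G⁻¹]` alone does not; for the planner: "schön" cannot be
  weakened to "some/every regular principal open".
* `schonClause_fails_for_reembedding`, `reembedding_extIdeal_eq` (the route's `I'` at these data is
  `⟨(𝕏−1)² − 𝕐⟩`), `reembedding_extIdeal_isPrime` (via the landed presentation
  `tropicalLinks_extIdeal_presentation`: `k[ℤ²] ⧸ I' ≃ₐ[k] (k[ℤ¹] ⧸ ⊥)[G⁻¹]`, a domain),
  `reembedding_guard`; read-back `schonClause_of_antecedent` / `schonResolves_antecedent_readback`
  (`Iff.rfl`: the clause text IS the crux's, under `open scoped Classical` as the route elaborates it).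
* `witness_not_isSchonIdeal` (§1): the same in the tree's vocabulary,
  `¬ IsSchonIdeal ⟨(𝕏−1)² − 𝕐⟩`, with `in_{(0,1)}⟨(𝕏−1)² − 𝕐⟩ = ⟨(𝕏−1)²⟩` (`witness_weightInitialIdeal`).
* DICTIONARY LEMMAS used (companion file `Negative/InitialFormMul.lean`, general, reusable by every
  prover on this route; they belong in `Literature/AlgebraicGeometry/Tropical/InitialIdeal`):
  `initialForm_eq_of_forall` (characterisation of `in_φ f`), **`initialForm_mul`**
  (`in_φ(fg) = in_φ(f) in_φ(g)` over coefficients without zero divisors, exponents with unique sums,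
  additive weight into an ordered cancellative monoid), **`initialIdeal_span_singleton`**
  (`in_φ⟨f⟩ = ⟨in_φ f⟩`), and `exists_not_isRegularLocalRing_of_eq_span_sq` (`L ⧸ ⟨ε²⟩` is regular
  at no prime, `ε` a nonzero non-unit of a domain; uses Matsumura 14.3 from the tree).

Nothing here refutes or weakens the crux (its conclusion is an instance of the summit); the file is
sorry-free and definition-free (the monomials `𝕏 = x^{(e₀,0)}`, `𝕐 = x^{(0,e₀)}`, `x₁ = x^{e₀}` and the
weight `𝕨 = (0,1)` of the docstrings are written out in the statements), axioms
`propext`/`Classical.choice`/`Quot.sound`.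
-/

noncomputable section

-- single-problem summit: the doubled namespace component `ResolutionOfSingularities` is forced
set_option linter.dupNamespace false

namespace Summit.ResolutionOfSingularities.ResolutionOfSingularities.Theorems.SchonResolves.Negative

open AddMonoidAlgebra Pointwise
open Literature.AlgebraicGeometry.Tropical
open Summit.ResolutionOfSingularities.ResolutionOfSingularities.Theses.TropicalLinks

/-! ## §1 The witness: `U' = {y = (x−1)²} ⊆ 𝔾_m²` (≅ 𝔾_m ∖ {1}, smooth) is not schön at `w = (0,1)`

Coordinates are written exactly as the route writes its re-embedding `k[ℤ^N] → k[ℤ^(N+m)]` at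
`N = m = 1`: `𝕏 = x^{(e₀, 0)}` (the old torus coordinate), `𝕐 = x^{(0, e₀)}` (the new unit
coordinate `y₀`), weight `𝕨 = (0, 1)`. -/

section Witness

variable (k : Type) [Field k]


/-- `Fin.append u v 0 = u 0` on `Fin (1+1)` (literal index). [folklore] -/
theorem fin_append_apply_zero (u v : Fin 1 → ℤ) : Fin.append u v (0 : Fin (1 + 1)) = u 0 :=
  Fin.append_left u v 0

/-- `Fin.append u v 1 = v 0` on `Fin (1+1)` (literal index). [folklore] -/
theorem fin_append_apply_one (u v : Fin 1 → ℤ) : Fin.append u v (1 : Fin (1 + 1)) = v 0 :=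
  Fin.append_right u v 0

/-- The weight `𝕨 = (0,1)` weighs an exponent by its `y`-coordinate. [folklore] -/
theorem witness_dotWeight (v : Fin (1 + 1) → ℤ) : dotWeight (Fin.append (0 : Fin 1 → ℤ) (fun _ : Fin 1 => (1 : ℤ)) : Fin (1 + 1) → ℤ) v = v 1 := by
  rw [dotWeight_apply, Fin.sum_univ_add]
  simp only [Finset.univ_unique, Fin.default_eq_zero, Finset.sum_singleton]
  rw [Fin.append_left, Fin.append_right]
  simp only [Pi.zero_apply, zero_mul, zero_add, one_mul]
  rfl

/-- `𝕏 − 1 ≠ 0`. [folklore] -/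
theorem witness_X_sub_one_ne_zero : (AddMonoidAlgebra.single (Fin.append (Pi.single (0 : Fin 1) (1 : ℤ)) (0 : Fin 1 → ℤ)) (1 : k) : AddMonoidAlgebra k (Fin (1 + 1) → ℤ)) - 1 ≠ 0 := by
  intro h
  rw [sub_eq_zero, one_def, single_left_inj one_ne_zero] at h
  have := congr_fun h 0
  rw [fin_append_apply_zero, Pi.single_eq_same, Pi.zero_apply] at this
  exact one_ne_zero this

/-- `𝕏 − 1` is not a unit (it dies under the augmentation `x^v ↦ 1`). [folklore] -/
theorem witness_not_isUnit_X_sub_one : ¬ IsUnit ((AddMonoidAlgebra.single (Fin.append (Pi.single (0 : Fin 1) (1 : ℤ)) (0 : Fin 1 → ℤ)) (1 : k) : AddMonoidAlgebra k (Fin (1 + 1) → ℤ)) - 1) := by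
  intro h
  set ev : AddMonoidAlgebra k (Fin (1 + 1) → ℤ) →ₐ[k] k :=
    AddMonoidAlgebra.lift k k (Fin (1 + 1) → ℤ) 1 with hev
  have h1 : ev (AddMonoidAlgebra.single (Fin.append (Pi.single (0 : Fin 1) (1 : ℤ)) (0 : Fin 1 → ℤ)) (1 : k) : AddMonoidAlgebra k (Fin (1 + 1) → ℤ)) = 1 := by
    rw [hev, lift_single]
    simp
  have h3 : ev 1 = 1 := map_one ev
  have h2 := h.map ev
  rw [map_sub, h1, h3, sub_self] at h2
  exact not_isUnit_zero h2

/-- Every exponent of `(𝕏 − 1)²` has `y`-coordinate `0` (it is homogeneous of degree `0` for the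
grading by the `y`-exponent). [folklore] -/
theorem witness_sq_mem_gradeBy :
    ((AddMonoidAlgebra.single (Fin.append (Pi.single (0 : Fin 1) (1 : ℤ)) (0 : Fin 1 → ℤ)) (1 : k) : AddMonoidAlgebra k (Fin (1 + 1) → ℤ)) - 1) ^ 2 ∈ gradeBy k (Pi.evalAddMonoidHom (fun _ : Fin (1 + 1) => ℤ) 1) 0 := by
  have hX : (AddMonoidAlgebra.single (Fin.append (Pi.single (0 : Fin 1) (1 : ℤ)) (0 : Fin 1 → ℤ)) (1 : k) : AddMonoidAlgebra k (Fin (1 + 1) → ℤ)) ∈ gradeBy k (Pi.evalAddMonoidHom (fun _ : Fin (1 + 1) => ℤ) 1) 0 := by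
    intro m hm
    rw [coeff_single] at hm
    rw [Finset.mem_singleton.mp (Finsupp.support_single_subset hm)]
    simp only [Pi.evalAddMonoidHom_apply, fin_append_apply_one, Pi.zero_apply]
  have h1 : (1 : AddMonoidAlgebra k (Fin (1 + 1) → ℤ)) ∈
      gradeBy k (Pi.evalAddMonoidHom (fun _ : Fin (1 + 1) => ℤ) 1) 0 :=
    SetLike.one_mem_graded _
  have hsub : (AddMonoidAlgebra.single (Fin.append (Pi.single (0 : Fin 1) (1 : ℤ)) (0 : Fin 1 → ℤ)) (1 : k) : AddMonoidAlgebra k (Fin (1 + 1) → ℤ)) - 1 ∈ gradeBy k (Pi.evalAddMonoidHom (fun _ : Fin (1 + 1) => ℤ) 1) 0 :=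
    Submodule.sub_mem _ hX h1
  simpa using SetLike.pow_mem_graded 2 hsub

/-- **`in_{(0,1)}((𝕏−1)² − 𝕐) = (𝕏−1)²`**: the `y`-free part is the lowest-weight part. [folklore] -/
theorem witness_initialForm : initialForm (dotWeight (Fin.append (0 : Fin 1 → ℤ) (fun _ : Fin 1 => (1 : ℤ)) : Fin (1 + 1) → ℤ)) (((AddMonoidAlgebra.single (Fin.append (Pi.single (0 : Fin 1) (1 : ℤ)) (0 : Fin 1 → ℤ)) (1 : k) : AddMonoidAlgebra k (Fin (1 + 1) → ℤ)) - 1) ^ 2 - (AddMonoidAlgebra.single (Fin.append (0 : Fin 1 → ℤ) (Pi.single (0 : Fin 1) (1 : ℤ))) (1 : k) : AddMonoidAlgebra k (Fin (1 + 1) → ℤ))) = ((AddMonoidAlgebra.single (Fin.append (Pi.single (0 : Fin 1) (1 : ℤ)) (0 : Fin 1 → ℤ)) (1 : k) : AddMonoidAlgebra k (Fin (1 + 1) → ℤ)) - 1) ^ 2 := by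
  have hg : ∀ u ∈ (((AddMonoidAlgebra.single (Fin.append (Pi.single (0 : Fin 1) (1 : ℤ)) (0 : Fin 1 → ℤ)) (1 : k) : AddMonoidAlgebra k (Fin (1 + 1) → ℤ)) - 1) ^ 2).coeff.support, u 1 = 0 := fun u hu =>
    witness_sq_mem_gradeBy k u hu
  have hY : ∀ u : Fin (1 + 1) → ℤ, u 1 = 0 → ((AddMonoidAlgebra.single (Fin.append (0 : Fin 1 → ℤ) (Pi.single (0 : Fin 1) (1 : ℤ))) (1 : k) : AddMonoidAlgebra k (Fin (1 + 1) → ℤ))).coeff u = 0 := by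
    intro u hu
    rw [coeff_single, Finsupp.single_apply, if_neg]
    intro h
    rw [← h, fin_append_apply_one, Pi.single_eq_same] at hu
    exact one_ne_zero hu
  refine initialForm_eq_of_forall (c := 0) ?_ ?_ ?_ (pow_ne_zero 2 (witness_X_sub_one_ne_zero k))
  · intro u hu
    rw [witness_dotWeight]
    by_cases h : u ∈ (((AddMonoidAlgebra.single (Fin.append (Pi.single (0 : Fin 1) (1 : ℤ)) (0 : Fin 1 → ℤ)) (1 : k) : AddMonoidAlgebra k (Fin (1 + 1) → ℤ)) - 1) ^ 2).coeff.support
    · rw [hg u h]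
    · rw [Finsupp.mem_support_iff, not_not] at h
      rw [coeff_sub, Finsupp.mem_support_iff, Finsupp.sub_apply, h, zero_sub, neg_ne_zero,
        coeff_single, Finsupp.single_apply] at hu
      split_ifs at hu with h'
      · rw [← h', fin_append_apply_one, Pi.single_eq_same]
        exact zero_le_one
      · exact absurd rfl hu
  · intro u hu
    rw [witness_dotWeight] at hu
    rw [coeff_sub, Finsupp.sub_apply, hY u hu, sub_zero]
  · intro u hu
    rw [witness_dotWeight]
    exact hg u hu

/-- **`in_{(0,1)}⟨(𝕏−1)² − 𝕐⟩ = ⟨(𝕏−1)²⟩`** (principal ideal: `initialIdeal_span_singleton`). [folklore] -/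
theorem witness_weightInitialIdeal :
    weightInitialIdeal (Fin.append (0 : Fin 1 → ℤ) (fun _ : Fin 1 => (1 : ℤ)) : Fin (1 + 1) → ℤ) (Ideal.span {((AddMonoidAlgebra.single (Fin.append (Pi.single (0 : Fin 1) (1 : ℤ)) (0 : Fin 1 → ℤ)) (1 : k) : AddMonoidAlgebra k (Fin (1 + 1) → ℤ)) - 1) ^ 2 - (AddMonoidAlgebra.single (Fin.append (0 : Fin 1 → ℤ) (Pi.single (0 : Fin 1) (1 : ℤ))) (1 : k) : AddMonoidAlgebra k (Fin (1 + 1) → ℤ))}) = Ideal.span {((AddMonoidAlgebra.single (Fin.append (Pi.single (0 : Fin 1) (1 : ℤ)) (0 : Fin 1 → ℤ)) (1 : k) : AddMonoidAlgebra k (Fin (1 + 1) → ℤ)) - 1) ^ 2} := by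
  show initialIdeal (dotWeight (Fin.append (0 : Fin 1 → ℤ) (fun _ : Fin 1 => (1 : ℤ)) : Fin (1 + 1) → ℤ)) _ = _
  rw [initialIdeal_span_singleton _ (dotWeight_add (Fin.append (0 : Fin 1 → ℤ) (fun _ : Fin 1 => (1 : ℤ)) : Fin (1 + 1) → ℤ)), witness_initialForm]

/-- **The smooth very affine curve `{y = (x−1)²} ⊆ 𝔾_m²` is NOT schön in this embedding**
(`Literature…Tropical.IsSchonIdeal` fails): its initial degeneration at `w = (0,1)` is
`k[x^±, y^±] ⧸ ⟨(x−1)²⟩`, regular at no prime (`exists_not_isRegularLocalRing_of_eq_span_sq`). Any field `k`. [folklore] -/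
theorem witness_not_isSchonIdeal : ¬ IsSchonIdeal (Ideal.span {((AddMonoidAlgebra.single (Fin.append (Pi.single (0 : Fin 1) (1 : ℤ)) (0 : Fin 1 → ℤ)) (1 : k) : AddMonoidAlgebra k (Fin (1 + 1) → ℤ)) - 1) ^ 2 - (AddMonoidAlgebra.single (Fin.append (0 : Fin 1 → ℤ) (Pi.single (0 : Fin 1) (1 : ℤ))) (1 : k) : AddMonoidAlgebra k (Fin (1 + 1) → ℤ))}) := by
  intro h
  obtain ⟨P, hP, hbad⟩ := exists_not_isRegularLocalRing_of_eq_span_sq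
    (witness_X_sub_one_ne_zero k) (witness_not_isUnit_X_sub_one k) (witness_weightInitialIdeal k)
  exact hbad (h _ P)

end Witness

/-! ## §2 In the route's own terms: a guard-passing re-embedding of `U = 𝔾_m` that violates the
schön clause of `SchonAt p 1` -/

section RouteNative

open scoped Classical

variable (k : Type) [Field k]


/-- `x₁ − 1 ≠ 0` in `k[ℤ¹]`. [folklore] -/
theorem reembedding_x_sub_one_ne_zero : (AddMonoidAlgebra.single (Pi.single (0 : Fin 1) (1 : ℤ)) (1 : k) : AddMonoidAlgebra k (Fin 1 → ℤ)) - 1 ≠ 0 := by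
  intro h
  rw [sub_eq_zero, one_def, single_left_inj one_ne_zero] at h
  have := congr_fun h 0
  simp at this

/-- The route's lattice embedding `ι : k[ℤ¹] → k[ℤ²]`, `ι f = ofCoeff (f.coeff.mapDomain (v ↦ (v,0)))`,
sends `(x₁ − 1)²` to `(𝕏 − 1)²` (it is the `k`-algebra map `k[v ↦ (v,0)]`). [folklore] -/
theorem reembedding_iota_sq :
    (AddMonoidAlgebra.ofCoeff ((((AddMonoidAlgebra.single (Pi.single (0 : Fin 1) (1 : ℤ)) (1 : k) : AddMonoidAlgebra k (Fin 1 → ℤ)) - 1) ^ 2).coeff.mapDomain fun v => Fin.append v (0 : Fin 1 → ℤ)) :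
      AddMonoidAlgebra k (Fin (1 + 1) → ℤ)) = ((AddMonoidAlgebra.single (Fin.append (Pi.single (0 : Fin 1) (1 : ℤ)) (0 : Fin 1 → ℤ)) (1 : k) : AddMonoidAlgebra k (Fin (1 + 1) → ℤ)) - 1) ^ 2 := by
  let ιₐ : AddMonoidAlgebra k (Fin 1 → ℤ) →ₐ[k] AddMonoidAlgebra k (Fin (1 + 1) → ℤ) :=
    AddMonoidAlgebra.mapDomainAlgHom k k
      { toFun := fun v => Fin.append v (0 : Fin 1 → ℤ)
        map_zero' := by
          funext i
          refine Fin.addCases (fun i => ?_) (fun i => ?_) i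
          · rw [Fin.append_left]; rfl
          · rw [Fin.append_right]; rfl
        map_add' := fun u v => by
          funext i
          refine Fin.addCases (fun i => ?_) (fun i => ?_) i
          · rw [Pi.add_apply, Fin.append_left, Fin.append_left, Fin.append_left]; rfl
          · rw [Pi.add_apply, Fin.append_right, Fin.append_right, Fin.append_right]
            exact (add_zero _).symm }
  have hι : ∀ f : AddMonoidAlgebra k (Fin 1 → ℤ), ιₐ f =
      AddMonoidAlgebra.ofCoeff (f.coeff.mapDomain fun v => Fin.append v (0 : Fin 1 → ℤ)) := fun f => rfl
  have hιx : ιₐ (AddMonoidAlgebra.single (Pi.single (0 : Fin 1) (1 : ℤ)) (1 : k) : AddMonoidAlgebra k (Fin 1 → ℤ)) = (AddMonoidAlgebra.single (Fin.append (Pi.single (0 : Fin 1) (1 : ℤ)) (0 : Fin 1 → ℤ)) (1 : k) : AddMonoidAlgebra k (Fin (1 + 1) → ℤ)) := by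
    rw [AddMonoidAlgebra.mapDomainAlgHom_apply, AddMonoidAlgebra.mapDomain_single]
    rfl
  rw [← hι, map_pow, map_sub, map_one, hιx]

/-- **The route's extended ideal `I'` at `(N, I, m, G) = (1, ⊥, 1, (x₁−1)²)` is `⟨(𝕏−1)² − 𝕐⟩`**
(`ι(⊥) = 0`, one new generator `y₀ − ι((x₁−1)²) = 𝕐 − (𝕏−1)²`). [folklore] -/
theorem reembedding_extIdeal_eq :
    Ideal.span ((fun f : AddMonoidAlgebra k (Fin 1 → ℤ) => (AddMonoidAlgebra.ofCoeff (f.coeff.mapDomain fun v => Fin.append v (0 : Fin 1 → ℤ)) : AddMonoidAlgebra k (Fin (1 + 1) → ℤ))) '' (↑(⊥ : Ideal (AddMonoidAlgebra k (Fin 1 → ℤ))) : Set (AddMonoidAlgebra k (Fin 1 → ℤ))) ∪ Set.range (fun j : Fin 1 => AddMonoidAlgebra.single (Fin.append (0 : Fin 1 → ℤ) (Pi.single j (1 : ℤ))) (1 : k) - AddMonoidAlgebra.ofCoeff (((fun _ : Fin 1 => ((AddMonoidAlgebra.single (Pi.single (0 : Fin 1) (1 : ℤ)) (1 : k) : AddMonoidAlgebra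 k (Fin 1 → ℤ)) - 1) ^ 2) j).coeff.mapDomain fun v => Fin.append v (0 : Fin 1 → ℤ)))) = Ideal.span {((AddMonoidAlgebra.single (Fin.append (Pi.single (0 : Fin 1) (1 : ℤ)) (0 : Fin 1 → ℤ)) (1 : k) : AddMonoidAlgebra k (Fin (1 + 1) → ℤ)) - 1) ^ 2 - (AddMonoidAlgebra.single (Fin.append (0 : Fin 1 → ℤ) (Pi.single (0 : Fin 1) (1 : ℤ))) (1 : k) : AddMonoidAlgebra k (Fin (1 + 1) → ℤ))} := by
  have h0 : ((fun f : AddMonoidAlgebra k (Fin 1 → ℤ) => (AddMonoidAlgebra.ofCoeff (f.coeff.mapDomain fun v => Fin.append v (0 : Fin 1 → ℤ)) : AddMonoidAlgebra k (Fin (1 + 1) → ℤ))) '' (↑(⊥ : Ideal (AddMonoidAlgebra k (Fin 1 → ℤ))) : Set (AddMonoidAlgebra k (Fin 1 → ℤ)))) = {0} := by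
    rw [Submodule.bot_coe, Set.image_singleton, coeff_zero, Finsupp.mapDomain_zero, ofCoeff_zero]
  rw [h0, Set.range_unique, Set.singleton_union, Ideal.span_insert_zero]
  simp only [Fin.default_eq_zero]
  rw [reembedding_iota_sq, ← Ideal.span_singleton_neg, neg_sub]

/-- **… and it is PRIME**: by the landed presentation `k[ℤ²] ⧸ I' ≃ₐ[k] (k[ℤ¹] ⧸ ⊥)[((x₁−1)²)⁻¹]`
(`tropicalLinks_extIdeal_presentation`) the quotient is a localization of a domain at a nonzero
element, hence a domain: `U' = U[G⁻¹] = 𝔾_m ∖ {1}` is an integral (smooth) curve. [folklore] -/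
theorem reembedding_extIdeal_isPrime : (Ideal.span ((fun f : AddMonoidAlgebra k (Fin 1 → ℤ) => (AddMonoidAlgebra.ofCoeff (f.coeff.mapDomain fun v => Fin.append v (0 : Fin 1 → ℤ)) : AddMonoidAlgebra k (Fin (1 + 1) → ℤ))) '' (↑(⊥ : Ideal (AddMonoidAlgebra k (Fin 1 → ℤ))) : Set (AddMonoidAlgebra k (Fin 1 → ℤ))) ∪ Set.range (fun j : Fin 1 => AddMonoidAlgebra.single (Fin.append (0 : Fin 1 → ℤ) (Pi.single j (1 : ℤ))) (1 : k) - AddMonoidAlgebra.ofCoeff (((fun _ : Fin 1 => ((AddMonoidAlgebra.single (Pi.single (0 : Fin 1) (1 : ℤ)) (1 : k) : AddMonoidAlgebra k (Fin 1 → ℤ)) - 1) ^ 2) j).coeff.mapDomain fun v => Fin.append v (0 : Fin 1 → ℤ))))).IsPrime := by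
  obtain ⟨e, -, -⟩ := Summit.ResolutionOfSingularities.ResolutionOfSingularities.Theorems.tropicalLinks_extIdeal_presentation
    k 1 1 (⊥ : Ideal (AddMonoidAlgebra k (Fin 1 → ℤ))) (fun _ : Fin 1 => ((AddMonoidAlgebra.single (Pi.single (0 : Fin 1) (1 : ℤ)) (1 : k) : AddMonoidAlgebra k (Fin 1 → ℤ)) - 1) ^ 2) _ rfl
  have hx : Ideal.Quotient.mk (⊥ : Ideal (AddMonoidAlgebra k (Fin 1 → ℤ))) (∏ j : Fin 1, (fun _ : Fin 1 => ((AddMonoidAlgebra.single (Pi.single (0 : Fin 1) (1 : ℤ)) (1 : k) : AddMonoidAlgebra k (Fin 1 → ℤ)) - 1) ^ 2) j) ≠ 0 := by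
    rw [Ne, Ideal.Quotient.eq_zero_iff_mem, Ideal.mem_bot]
    simp only [Finset.univ_unique, Finset.prod_singleton]
    exact pow_ne_zero 2 (reembedding_x_sub_one_ne_zero k)
  haveI : IsDomain (Localization.Away (Ideal.Quotient.mk (⊥ : Ideal (AddMonoidAlgebra k (Fin 1 → ℤ))) (∏ j : Fin 1, (fun _ : Fin 1 => ((AddMonoidAlgebra.single (Pi.single (0 : Fin 1) (1 : ℤ)) (1 : k) : AddMonoidAlgebra k (Fin 1 → ℤ)) - 1) ^ 2) j))) :=
    IsLocalization.isDomain_of_le_nonZeroDivisors _ (powers_le_nonZeroDivisors_of_noZeroDivisors hx)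
  exact (Ideal.Quotient.isDomain_iff_prime _).1 (MulEquiv.isDomain _ e.toMulEquiv)

/-- The pair `G = ((x₁−1)²)` passes the route's guard `∀ j, G j ∉ I` at `I = ⊥`. [folklore] -/
theorem reembedding_guard : ∀ j : Fin 1, (fun _ : Fin 1 => ((AddMonoidAlgebra.single (Pi.single (0 : Fin 1) (1 : ℤ)) (1 : k) : AddMonoidAlgebra k (Fin 1 → ℤ)) - 1) ^ 2) j ∉ (⊥ : Ideal (AddMonoidAlgebra k (Fin 1 → ℤ))) := by
  intro j
  rw [Ideal.mem_bot]
  exact pow_ne_zero 2 (reembedding_x_sub_one_ne_zero k)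

/-- **MAIN (route-native).** The schön clause of the crux's antecedent — verbatim the route's
`∀ w P, IsRegularLocalRing (Localization.AtPrime P)` over `k[ℤ^(N+m)] ⧸ in_w(I')` — FAILS for the
guard-passing data `(k, N, I, m, G) = (k, 1, ⊥, 1, (x₁−1)²)`, i.e. for `U = 𝔾_m` (prime `I = ⊥`,
dimension 1) re-embedded as the smooth curve `U' = U[G⁻¹] = {y = (x−1)²} ⊆ 𝔾_m²`: at `w = (0,1)` the
degeneration is `k[x^±,y^±] ⧸ ⟨(x−1)²⟩`. Any field `k` (so every `p`, every `k̄`). [folklore] -/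
theorem schonClause_fails_for_reembedding :
    ¬ (∀ (w : Fin (1 + 1) → ℤ) (P : Ideal (AddMonoidAlgebra k (Fin (1 + 1) → ℤ) ⧸ Ideal.span ((fun f : AddMonoidAlgebra k (Fin (1 + 1) → ℤ) => AddMonoidAlgebra.ofCoeff (f.coeff.filter fun v => ∀ u ∈ f.coeff.support, ∑ i, w i * v i ≤ ∑ i, w i * u i)) '' (↑(Ideal.span ((fun f : AddMonoidAlgebra k (Fin 1 → ℤ) => (AddMonoidAlgebra.ofCoeff (f.coeff.mapDomain fun v => Fin.append v (0 : Fin 1 → ℤ)) : AddMonoidAlgebra k (Fin (1 + 1) → ℤ))) '' (↑(⊥ : Ideal (AddMonoidAlgebra k (Fin 1 → ℤ))) : Set (AddMonoidAlgebra k (Fin 1 → ℤ))) ∪ Set.range (fun j : Fin 1 => AddMonoidAlgebra.single (Fin.append (0 : Fin 1 → ℤ) (Pi.single j (1 : ℤ))) (1 : k) - AddMonoidAlgebra.ofCoeff (((fun _ : Fin 1 => ((AddMonoidAlgebra.single (Pi.single (0 : Fin 1) (1 : ℤ)) (1 : k) : AddMonoidAlgebra k (Fin 1 → ℤ)) - 1)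 ^ 2) j).coeff.mapDomain fun v => Fin.append v (0 : Fin 1 → ℤ))))) : Set (AddMonoidAlgebra k (Fin (1 + 1) → ℤ)))))) [P.IsPrime], IsRegularLocalRing (Localization.AtPrime P)) := by
  intro h
  have key : ∀ (J : Ideal (AddMonoidAlgebra k (Fin (1 + 1) → ℤ))), J = Ideal.span {((AddMonoidAlgebra.single (Fin.append (Pi.single (0 : Fin 1) (1 : ℤ)) (0 : Fin 1 → ℤ)) (1 : k) : AddMonoidAlgebra k (Fin (1 + 1) → ℤ)) - 1) ^ 2} →
      (∀ (P : Ideal (AddMonoidAlgebra k (Fin (1 + 1) → ℤ) ⧸ J)) [P.IsPrime],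
        IsRegularLocalRing (Localization.AtPrime P)) → False := by
    intro J hJ hreg
    obtain ⟨P, hP, hbad⟩ := exists_not_isRegularLocalRing_of_eq_span_sq
      (witness_X_sub_one_ne_zero k) (witness_not_isUnit_X_sub_one k) hJ
    exact hbad (@hreg P hP)
  refine key _ ?_ (h (Fin.append (0 : Fin 1 → ℤ) (fun _ : Fin 1 => (1 : ℤ)) : Fin (1 + 1) → ℤ))
  refine (Summit.ResolutionOfSingularities.ResolutionOfSingularities.Theorems.tropicalLinks_weightInitialIdeal_eq_span (Fin.append (0 : Fin 1 → ℤ) (fun _ : Fin 1 => (1 : ℤ)) : Fin (1 + 1) → ℤ) _ _).symm.trans ?_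
  rw [reembedding_extIdeal_eq]
  exact witness_weightInitialIdeal k

/-- **The `∃ (m, G)` of `SchonAt` is a genuine choice** (it cannot be strengthened to "every
guard-passing re-embedding"): for `U = 𝔾_m ⊆ 𝔾_m¹` (`N = 1`, `I = ⊥` prime, `dim = 1`) there are
`m` and `G` with `∀ j, G j ∉ I` for which the schön clause fails — although `U[G⁻¹] = 𝔾_m ∖ {1}` is
regular (so the clause holds at `w = 0`) and although `U` itself is schön with `m = 0`. The clause at
`w ≠ 0` sees the EMBEDDING, not only the variety: `G = (x₁−1)²` embeds `U[G⁻¹]` through a sublattice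
of index 2 of its unit lattice `⟨x₁, x₁−1⟩`, and the missing unit `x₁ − 1` shows up as the
non-reduced initial form `(x−1)²`; adjoining it as a further `G` (the intrinsic embedding, Luxton–Qu
2011 Lemma 2.13) repairs schön-ness (on paper: `in_w⟨y − z², z − x + 1⟩` is reduced for all `w`).
Displayed: the route's `(∀ j, G j ∉ I) ∧`-clause at `N = 1`, `I = ⊥`, negated inside. [folklore] -/
theorem exists_guarded_reembedding_not_schonClause :
    ∃ (m : ℕ) (G : Fin m → AddMonoidAlgebra k (Fin 1 → ℤ)), (∀ j, G j ∉ (⊥ : Ideal (AddMonoidAlgebra k (Fin 1 → ℤ)))) ∧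
      ¬ (∀ (w : Fin (1 + m) → ℤ) (P : Ideal (AddMonoidAlgebra k (Fin (1 + m) → ℤ) ⧸ Ideal.span ((fun f : AddMonoidAlgebra k (Fin (1 + m) → ℤ) => AddMonoidAlgebra.ofCoeff (f.coeff.filter fun v => ∀ u ∈ f.coeff.support, ∑ i, w i * v i ≤ ∑ i, w i * u i)) '' (↑(Ideal.span ((fun f : AddMonoidAlgebra k (Fin 1 → ℤ) => (AddMonoidAlgebra.ofCoeff (f.coeff.mapDomain fun v => Fin.append v (0 : Fin m → ℤ)) : AddMonoidAlgebra k (Fin (1 + m) → ℤ))) '' (↑(⊥ : Ideal (AddMonoidAlgebra k (Fin 1 → ℤ))) : Set (AddMonoidAlgebra k (Fin 1 → ℤ))) ∪ Set.range (fun j : Fin m => AddMonoidAlgebra.single (Fin.append (0 : Fin 1 → ℤ) (Pi.single j (1 : ℤ))) (1 : k) - AddMonoidAlgebra.ofCoeff ((G j).coeff.mapDomain fun v => Fin.append v (0 : Fin m → ℤ))))) : Set (AddMonoidAlgebra k (Fin (1 + m) → ℤ)))))) [P.IsPrime], IsRegularLocalRing (Localization.AtPrime P)) := by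
  exact ⟨1, fun _ : Fin 1 => ((AddMonoidAlgebra.single (Pi.single (0 : Fin 1) (1 : ℤ)) (1 : k) : AddMonoidAlgebra k (Fin 1 → ℤ)) - 1) ^ 2, reembedding_guard k, schonClause_fails_for_reembedding k⟩

end RouteNative

/-! ## §3 Read-back against the crux: the clause above IS the antecedent's clause -/

section ReadBack

open scoped Classical

/-- **Read-back.** From the antecedent `∀ d, SchonAt p d` of `SchonResolves` (the route's inlined
lambda, copied verbatim) one gets, for every prime `I` of dimension `d`, the guarded clause in exactly
the form negated in §2 (`exact h d k N I hI hd`): the text of §2 is the crux's, specialised to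
`N = 1`, `I = ⊥`. [folklore] -/
theorem schonClause_of_antecedent (p : ℕ)
    (h : ∀ d : ℕ, (fun (p d : ℕ) => ∀ (k : Type) [Field k] [CharP k p] [IsAlgClosed k] (N : ℕ) (I : Ideal (AddMonoidAlgebra k (Fin N → ℤ))), I.IsPrime → ringKrullDim (AddMonoidAlgebra k (Fin N → ℤ) ⧸ I) = (d : WithBot ℕ∞) → ∃ (m : ℕ) (G : Fin m → AddMonoidAlgebra k (Fin N → ℤ)), (∀ j, G j ∉ I) ∧ ∀ (w : Fin (N + m) → ℤ) (P : Ideal (AddMonoidAlgebra k (Fin (N + m) → ℤ) ⧸ Ideal.span ((fun f : AddMonoidAlgebra k (Fin (N + m) → ℤ) => AddMonoidAlgebra.ofCoeff (f.coeff.filter fun v => ∀ u ∈ f.coeff.support, ∑ i, w i * v i ≤ ∑ i, w i * u i)) '' (↑(Ideal.span ((fun f : AddMonoidAlgebra k (Fin N → ℤ) => (AddMonoidAlgebra.ofCoeff (f.coeff.mapDomain fun v => Fin.append v (0 : Fin m → ℤ)) : AddMonoidAlgebra k (Fin (N + m) → ℤ))) '' (↑I : Set (AddMonoidAlgebra k (Fin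 N → ℤ))) ∪ Set.range (fun j : Fin m => AddMonoidAlgebra.single (Fin.append (0 : Fin N → ℤ) (Pi.single j (1 : ℤ))) (1 : k) - AddMonoidAlgebra.ofCoeff ((G j).coeff.mapDomain fun v => Fin.append v (0 : Fin m → ℤ))))) : Set (AddMonoidAlgebra k (Fin (N + m) → ℤ)))))) [P.IsPrime], IsRegularLocalRing (Localization.AtPrime P)) p d)
    (k : Type) [Field k] [CharP k p] [IsAlgClosed k] (N d : ℕ) (I : Ideal (AddMonoidAlgebra k (Fin N → ℤ)))
    (hI : I.IsPrime) (hd : ringKrullDim (AddMonoidAlgebra k (Fin N → ℤ) ⧸ I) = (d : WithBot ℕ∞)) :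
    ∃ (m : ℕ) (G : Fin m → AddMonoidAlgebra k (Fin N → ℤ)), (∀ j, G j ∉ I) ∧ ∀ (w : Fin (N + m) → ℤ) (P : Ideal (AddMonoidAlgebra k (Fin (N + m) → ℤ) ⧸ Ideal.span ((fun f : AddMonoidAlgebra k (Fin (N + m) → ℤ) => AddMonoidAlgebra.ofCoeff (f.coeff.filter fun v => ∀ u ∈ f.coeff.support, ∑ i, w i * v i ≤ ∑ i, w i * u i)) '' (↑(Ideal.span ((fun f : AddMonoidAlgebra k (Fin N → ℤ) => (AddMonoidAlgebra.ofCoeff (f.coeff.mapDomain fun v => Fin.append v (0 : Fin m → ℤ)) : AddMonoidAlgebra k (Fin (N + m) → ℤ))) '' (↑I : Set (AddMonoidAlgebra k (Fin N → ℤ))) ∪ Set.range (fun j : Fin m => AddMonoidAlgebra.single (Fin.append (0 : Fin N → ℤ) (Pi.single j (1 : ℤ))) (1 : k) - AddMonoidAlgebra.ofCoeff ((G j).coeff.mapDomain fun v => Fin.append v (0 : Fin m → ℤ))))) : Set (AddMonoidAlgebra k (Fin (N + m) → ℤ)))))) [P.IsPrime], IsRegularLocalRing (Localization.AtPrime P)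 :=
  h d k N I hI hd

/-- The same read-back from the crux's full hypothesis list: under `SchonResolves`'s binders, at a
prime `p`, the antecedent hands the prover SOME guarded re-embedding satisfying the clause — §2 shows
the prover cannot expect an ARBITRARY guarded re-embedding (even one with `U[G⁻¹]` regular) to do so.
[folklore] -/
theorem schonResolves_antecedent_readback :
    SchonResolves ↔ ∀ p : ℕ, p.Prime → (∀ d : ℕ, (fun (p d : ℕ) => ∀ (k : Type) [Field k] [CharP k p] [IsAlgClosed k] (N : ℕ) (I : Ideal (AddMonoidAlgebra k (Fin N → ℤ))), I.IsPrime → ringKrullDim (AddMonoidAlgebra k (Fin N → ℤ) ⧸ I) = (d : WithBot ℕ∞) → ∃ (m : ℕ) (G : Fin m → AddMonoidAlgebra k (Fin N → ℤ)), (∀ j, G j ∉ I) ∧ ∀ (w : Fin (N + m) → ℤ) (P : Ideal (AddMonoidAlgebra k (Fin (N + m) → ℤ) ⧸ Ideal.span ((fun f : AddMonoidAlgebra k (Fin (N + m) → ℤ) => AddMonoidAlgebra.ofCoeff (f.coeff.filter fun v => ∀ u ∈ f.coeff.support, ∑ i, w i * v i ≤ ∑ i, w i * u i)) '' (↑(Ideal.span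 ((fun f : AddMonoidAlgebra k (Fin N → ℤ) => (AddMonoidAlgebra.ofCoeff (f.coeff.mapDomain fun v => Fin.append v (0 : Fin m → ℤ)) : AddMonoidAlgebra k (Fin (N + m) → ℤ))) '' (↑I : Set (AddMonoidAlgebra k (Fin N → ℤ))) ∪ Set.range (fun j : Fin m => AddMonoidAlgebra.single (Fin.append (0 : Fin N → ℤ) (Pi.single j (1 : ℤ))) (1 : k) - AddMonoidAlgebra.ofCoeff ((G j).coeff.mapDomain fun v => Fin.append v (0 : Fin m → ℤ))))) : Set (AddMonoidAlgebra k (Fin (N + m) → ℤ)))))) [P.IsPrime], IsRegularLocalRing (Localization.AtPrime P)) p d) →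
      ∀ (k : Type) [Field k] [CharP k p] [IsAlgClosed k] (X : AlgebraicGeometry.Scheme.{0})
        (f : X ⟶ AlgebraicGeometry.Spec (.of k)), AlgebraicGeometry.IsSeparated f →
        AlgebraicGeometry.LocallyOfFiniteType f → AlgebraicGeometry.QuasiCompact f →
        AlgebraicGeometry.IsIntegral X → Literature.AlgebraicGeometry.Resolution.Scheme.HasResolution X :=
  Iff.rfl

end ReadBack

end Summit.ResolutionOfSingularities.ResolutionOfSingularities.Theorems.SchonResolves.Negative

end
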